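import Literature.MathematicalPhysics.KineticTheory.HardSphereEulerProofs
import Literature.Analysis.FluidPDE.HardSphereTorusMeasure
import Literature.Barriers.AtomisticToContinuum.BoltzmannHypothesis

/-!
# `CorrectorPressureDecay` — negative knowledge: the free gas IS a hard-sphere flow of diameter `0`

Support file for crux `stmt-AtomisticToContinuum-14135` (`AntiMazurCoboundaries.CorrectorPressureDecay`, "X"),
written by the standing disprover (cdisprove seat, cycle 2). It constructs, for every particle number `n`, an
inhabitant of the tree's hypothesis structure `HardSphereFlow (Torus.geometry (Fin 3)) 0 n` whose flow map is FREE
FLIGHT (`freeFlow`, `freeFlow_flow`), and hence an inhabitant `freeFlow₀ N` of the crux's own flow type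
`HardSphereFlow _ (hsDiameter 0 N) (N + 1)` at reduced diameter `σ = 0` (`hsDiameter 0 N = 0`). This discharges the
hypothesis `FreeFlowZeroDiameter` under which the cycle-1 disproof showed that X FAILS at `σ = 0` (collisions are
load-bearing); the unconditional refutation is `Negative/ZeroDiameter.lean`.

Construction. At diameter `0` the hard-sphere domain is everything and the contact set of a pair is the
COINCIDENCE set `xᵢ = xⱼ`, at which the trajectory axiom `binary` cannot hold (`IsIncoming` needs a non-zero
separation vector): a diameter-`0` trajectory must therefore be collision-free, i.e. pure free flight. The good set
is `good n = {z | ∀ i ≠ j, ∀ k ∈ ℤ³, ‖u‖²(r − k) ≠ ⟪r − k, u⟫ u}` (`r` = minimal-image relative position, `u` =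
relative velocity): no pair is collinear with a lattice translate. It is

* measurable (countable intersection of `{obstr ≠ 0}`, `measurableSet_good`);
* invariant: along the free flight `r(t) = r + t u + (lattice vector)` (`relPos_freeFlight`, from
  `proj_eq_proj_iff_holds`), which permutes the obstruction family (`obstr_freeFlight`);
* collision-free: a coincidence at time `t` means `r + t u ∈ ℤ³`, killing an obstruction
  (`relPos_freeFlight_ne_zero`, `collisionTimes_eq_empty`), so good orbits are hard-sphere trajectories
  (`isHardSphereTrajectory_freeFlight`);
* Liouville-conull (`volume_compl_good`): for fixed data of particle `j` and `xᵢ ≠ xⱼ` the bad `vᵢ` lie on a line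
  (`addHaar_submodule`), and `xᵢ = xⱼ` is one point of `𝕋³` (Haar on the circle has no atoms,
  `instNullSingletonClassUnitAddCircle`); Fubini one particle at a time (`volume_eq_zero_of_sections`, tree).

Liouville's theorem for the free flight is the tree's `measurePreserving_freeFlight_torus_holds`. All `[folklore]`.
-/

noncomputable section

open MeasureTheory Set Filter Topology Function
open scoped ENNReal InnerProductSpace

namespace Summit.AtomisticToContinuum.HydrodynamicLimit.Theorems.CorrectorPressureDecayNegative.FreeFlow

open Literature.Analysis.FluidPDE
open Literature.Analysis.FunctionSpaces.Torus (proj latticeVec latticeVec_apply proj_latticeVec proj_eq_proj_iff_holds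
  measurable_proj continuous_proj)
open Literature.MathematicalPhysics.KineticTheory (T3 V3 hsDiameter)

/-- The torus geometry of `𝕋³`. [folklore] -/
abbrev G3 : Geometry (Fin 3) T3 := Torus.geometry (Fin 3)

/-- Phase space of `n` point particles on `𝕋³`. [folklore] -/
abbrev TPhase (n : ℕ) : Type := Config n (Fin 3) T3

variable {n : ℕ}

/-- Minimal-image relative position of the pair `(i, j)`. [folklore] -/
def relPos (z : TPhase n) (i j : Fin n) : V3 := Torus.reprSym ((z i).1 - (z j).1)

/-- Relative velocity of the pair `(i, j)`. [folklore] -/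
def relVel (z : TPhase n) (i j : Fin n) : V3 := (z i).2 - (z j).2

/-- The collinearity obstruction of the pair `(i, j)` against the lattice translate `k`:
`‖u‖² (r − k) − ⟪r − k, u⟫ u`; it vanishes iff `r − k ∥ u` (or `u = 0`), i.e. iff the free orbit of the pair can
ever pass through the coincidence `xᵢ = xⱼ` via the lattice vector `k`. [folklore] -/
def obstr (k : Fin 3 → ℤ) (z : TPhase n) (i j : Fin n) : V3 :=
  ‖relVel z i j‖ ^ 2 • (relPos z i j - latticeVec k) - ⟪relPos z i j - latticeVec k, relVel z i j⟫_ℝ • relVel z i j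

/-- Good data: no pair is ever collinear with a lattice translate (in particular no two velocities coincide). [folklore] -/
def good (n : ℕ) : Set (TPhase n) := {z | ∀ i j : Fin n, i ≠ j → ∀ k : Fin 3 → ℤ, obstr k z i j ≠ 0}

/-- Shear invariance of the obstruction: `a ↦ a + t u` does not change `‖u‖² a − ⟪a, u⟫ u`. [folklore] -/
theorem obstr_add_smul (a u : V3) (t : ℝ) :
    ‖u‖ ^ 2 • (a + t • u) - ⟪a + t • u, u⟫_ℝ • u = ‖u‖ ^ 2 • a - ⟪a, u⟫_ℝ • u := by
  rw [inner_add_left, smul_add, add_smul, real_inner_smul_left, real_inner_self_eq_norm_sq,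
    show t * ‖u‖ ^ 2 = ‖u‖ ^ 2 * t from mul_comm _ _, mul_smul]
  abel

/-- If `r + t u = k` for a lattice vector `k`, the obstruction against `k` vanishes. [folklore] -/
theorem obstr_eq_zero_of (k : Fin 3 → ℤ) (r u : V3) (t : ℝ) (h : r + t • u = latticeVec k) :
    ‖u‖ ^ 2 • (r - latticeVec k) - ⟪r - latticeVec k, u⟫_ℝ • u = 0 := by
  have : r - latticeVec k = (-t) • u := by rw [← h]; simp [neg_smul]
  rw [this, real_inner_smul_left, real_inner_self_eq_norm_sq, smul_smul,
    show ‖u‖ ^ 2 * -t = -t * ‖u‖ ^ 2 from mul_comm _ _, sub_self]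

/-- The covering map is subtractive. [folklore] -/
theorem proj_sub' (x y : V3) : proj (x - y) = proj x - proj y := by
  rw [sub_eq_add_neg, Literature.Analysis.FunctionSpaces.Torus.proj_add,
    Literature.Analysis.FunctionSpaces.Torus.proj_neg, ← sub_eq_add_neg]

/-- Relative position along the free flight: `r(t) = r + t u + (lattice vector)`. [folklore] -/
theorem relPos_freeFlight (z : TPhase n) (i j : Fin n) (t : ℝ) :
    ∃ m : Fin 3 → ℤ, relPos (freeFlight G3 t z) i j = relPos z i j + t • relVel z i j + latticeVec m := by
  have h1 : proj (relPos (freeFlight G3 t z) i j) =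
      ((z i).1 + proj (t • (z i).2)) - ((z j).1 + proj (t • (z j).2)) := by
    simp only [relPos, freeFlight_apply, Torus.geometry_translate, Torus.proj_reprSym]
  have h2 : proj (relPos z i j + t • relVel z i j) =
      ((z i).1 - (z j).1) + (proj (t • (z i).2) - proj (t • (z j).2)) := by
    rw [Literature.Analysis.FunctionSpaces.Torus.proj_add, relPos, Torus.proj_reprSym, relVel, smul_sub, proj_sub']
  have hproj : proj (relPos z i j + t • relVel z i j) = proj (relPos (freeFlight G3 t z) i j) := by
    rw [h1, h2]; abel
  obtain ⟨m, hm⟩ := (proj_eq_proj_iff_holds _ _).1 hproj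
  exact ⟨m, hm⟩

/-- Free flight keeps relative velocities. [folklore] -/
@[simp] theorem relVel_freeFlight (z : TPhase n) (i j : Fin n) (t : ℝ) :
    relVel (freeFlight G3 t z) i j = relVel z i j := rfl

/-- `latticeVec` is subtractive. [folklore] -/
theorem latticeVec_sub (k m : Fin 3 → ℤ) : latticeVec (k - m) = latticeVec k - latticeVec m := by
  ext i; simp

/-- The obstruction family is permuted by the free flight. [folklore] -/
theorem obstr_freeFlight (k : Fin 3 → ℤ) (z : TPhase n) (i j : Fin n) (t : ℝ) :
    ∃ m : Fin 3 → ℤ, obstr k (freeFlight G3 t z) i j = obstr (k - m) z i j := by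
  obtain ⟨m, hm⟩ := relPos_freeFlight z i j t
  refine ⟨m, ?_⟩
  simp only [obstr, relVel_freeFlight, hm, latticeVec_sub]
  have : relPos z i j + t • relVel z i j + latticeVec m - latticeVec k =
      (relPos z i j - (latticeVec k - latticeVec m)) + t • relVel z i j := by abel
  rw [this, obstr_add_smul]

/-- On a good orbit no pair ever coincides: the minimal-image separation never vanishes. [folklore] -/
theorem relPos_freeFlight_ne_zero {z : TPhase n} (hz : z ∈ good n) {i j : Fin n} (hij : i ≠ j) (t : ℝ) :
    relPos (freeFlight G3 t z) i j ≠ 0 := by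
  obtain ⟨m, hm⟩ := relPos_freeFlight z i j t
  intro h0
  rw [h0] at hm
  -- `r + t u = latticeVec (-m)`
  have h : relPos z i j + t • relVel z i j = latticeVec (-m) := by
    have : latticeVec (-m) = -latticeVec m := by ext i; simp
    rw [this]; exact eq_neg_of_add_eq_zero_left hm.symm
  exact hz i j hij (-m) (obstr_eq_zero_of (-m) _ _ t h)

/-- Good data are preserved by the free flight. [folklore] -/
theorem freeFlight_mem_good {z : TPhase n} (hz : z ∈ good n) (t : ℝ) : freeFlight G3 t z ∈ good n := by
  intro i j hij k
  obtain ⟨m, hm⟩ := obstr_freeFlight k z i j t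
  rw [hm]
  exact hz i j hij (k - m)

/-- The separation vector of the torus geometry along the free orbit is the relative position. [folklore] -/
theorem sepVec_freeFlight (z : TPhase n) (i j : Fin n) (t : ℝ) :
    G3.sepVec (freeFlight G3 t z i).1 (freeFlight G3 t z j).1 = relPos (freeFlight G3 t z) i j := rfl

/-- Good orbits have no collision (= coincidence) times at diameter `0`. [folklore] -/
theorem collisionTimes_eq_empty {z : TPhase n} (hz : z ∈ good n) :
    collisionTimes G3 0 (fun t => freeFlight G3 t z) = ∅ := by
  refine Set.eq_empty_iff_forall_notMem.2 fun t ht => ?_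
  obtain ⟨i, j, hij, hc⟩ := mem_collisionTimes.1 ht
  have h := (mem_contactSet.1 hc).2
  rw [sepVec_freeFlight, norm_eq_zero] at h
  exact relPos_freeFlight_ne_zero hz hij t h

/-- At diameter `0` the hard-sphere domain is the whole phase space. [folklore] -/
theorem hardSphereDomain_zero : hardSphereDomain G3 n 0 = univ :=
  Set.eq_univ_of_forall fun _ => mem_hardSphereDomain.2 fun _ _ _ => norm_nonneg _

/-- Good orbits are hard-sphere trajectories of diameter `0` (collision-free free flight). [folklore] -/
theorem isHardSphereTrajectory_freeFlight {z : TPhase n} (hz : z ∈ good n) :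
    IsHardSphereTrajectory G3 0 n fun t => freeFlight G3 t z where
  mem t := by rw [hardSphereDomain_zero]; exact mem_univ _
  locFinite a b := by rw [collisionTimes_eq_empty hz, Set.empty_inter]; exact Set.finite_empty
  pos_continuous i := by
    simp only [freeFlight_apply, Torus.geometry_translate]
    exact continuous_const.add (continuous_proj.comp (continuous_id.smul continuous_const))
  free s t _ _ := by
    show freeFlight G3 t z = freeFlight G3 (t - s) (freeFlight G3 s z)
    rw [← freeFlight_add, sub_add_cancel]
  binary t i j hij hc := by
    exfalso
    have ht : t ∈ collisionTimes G3 0 (fun t => freeFlight G3 t z) := mem_collisionTimes.2 ⟨i, j, hij, hc⟩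
    rw [collisionTimes_eq_empty hz] at ht
    exact ht

/-! ### Measurability -/

/-- Minimal-image relative position is measurable. [folklore] -/
theorem measurable_relPos (i j : Fin n) : Measurable fun z : TPhase n => relPos z i j :=
  Torus.measurable_reprSym.comp ((measurable_pi_apply i).fst.sub (measurable_pi_apply j).fst)

/-- Relative velocity is measurable. [folklore] -/
theorem measurable_relVel (i j : Fin n) : Measurable fun z : TPhase n => relVel z i j :=
  (measurable_pi_apply i).snd.sub (measurable_pi_apply j).snd

/-- Each obstruction is measurable (`reprSym` is measurable, not continuous). [folklore] -/
theorem measurable_obstr (k : Fin 3 → ℤ) (i j : Fin n) : Measurable fun z : TPhase n => obstr k z i j := by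
  unfold obstr
  have hr := measurable_relPos (n := n) i j
  have hu := measurable_relVel (n := n) i j
  refine ((hu.norm.pow_const 2).smul (hr.sub measurable_const)).sub ?_
  exact (Measurable.inner (𝕜 := ℝ) (hr.sub measurable_const) hu).smul hu

/-- The good set is measurable (countable intersection over pairs and lattice vectors). [folklore] -/
theorem measurableSet_good : MeasurableSet (good n) := by
  have : good n = ⋂ i : Fin n, ⋂ j : Fin n, ⋂ (_ : i ≠ j), ⋂ k : Fin 3 → ℤ, {z | obstr k z i j ≠ 0} := by
    ext z; simp only [good, mem_setOf_eq, mem_iInter]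
  rw [this]
  refine MeasurableSet.iInter fun i => MeasurableSet.iInter fun j => MeasurableSet.iInter fun _ =>
    MeasurableSet.iInter fun k => ?_
  exact (measurable_obstr k i j) (measurableSet_singleton (0 : V3)).compl

/-- The free flight on `(𝕋³ × ℝ³)ⁿ` is measurable. [folklore] -/
theorem measurable_freeFlight_torus (t : ℝ) : Measurable (freeFlight (N := n) G3 t) := by
  refine measurable_pi_lambda _ fun i => ?_
  simp only [freeFlight_apply, Torus.geometry_translate]
  exact ((measurable_pi_apply i).fst.add (measurable_proj.comp ((measurable_pi_apply i).snd.const_smul t))).prodMk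
    (measurable_pi_apply i).snd


/-! ### The bad set is Liouville-null -/

/-- Haar measure on the unit circle has no atoms. [folklore] -/
theorem unitAddCircle_volume_singleton (x : UnitAddCircle) : (volume : Measure UnitAddCircle) {x} = 0 := by
  refine le_antisymm (ENNReal.le_of_forall_pos_le_add fun ε hε _ => ?_) bot_le
  calc (volume : Measure UnitAddCircle) {x} ≤ volume (Metric.closedBall x (ε / 2)) :=
        measure_mono (Set.singleton_subset_iff.2 (Metric.mem_closedBall_self (by positivity)))
    _ = ENNReal.ofReal (min 1 (2 * (ε / 2))) := AddCircle.volume_closedBall (T := 1) (x := x) (ε / 2)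
    _ ≤ ENNReal.ofReal ε := ENNReal.ofReal_le_ofReal (by
        have : 2 * ((ε : ℝ) / 2) = ε := by ring
        rw [this]; exact min_le_right _ _)
    _ = 0 + (ε : ℝ≥0∞) := by simp

/-- Haar measure on the unit circle, hence on `𝕋³`, charges no point. [folklore] -/
instance instNullSingletonClassUnitAddCircle : NullSingletonClass (volume : Measure UnitAddCircle) where
  measure_singleton := unitAddCircle_volume_singleton

/-- A line through the origin is a proper subspace of `ℝ³`. [folklore] -/
theorem span_singleton_ne_top (a : V3) (ha : a ≠ 0) : (ℝ ∙ a : Submodule ℝ V3) ≠ ⊤ := by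
  intro htop
  have h1 : Module.finrank ℝ (ℝ ∙ a : Submodule ℝ V3) = 1 := finrank_span_singleton ha
  rw [htop, finrank_top, finrank_euclideanSpace_fin] at h1
  norm_num at h1

/-- The vanishing set of one obstruction is Liouville-null (`i ≠ j`): for fixed data of particle `j` and fixed
`xᵢ ≠ xⱼ` the admissible `vᵢ` lie on a line, and `xᵢ = xⱼ` is a single point of `𝕋³`. [folklore] -/
theorem volume_setOf_obstr_eq_zero {i j : Fin n} (hij : i ≠ j) (k : Fin 3 → ℤ) :
    volume {z : TPhase n | obstr k z i j = 0} = 0 := by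
  have hS : MeasurableSet {z : TPhase n | obstr k z i j = 0} :=
    (measurable_obstr k i j) (measurableSet_singleton 0)
  refine volume_eq_zero_of_sections hS i fun z => ?_
  have hmeas : MeasurableSet {y : T3 × V3 | update z i y ∈ {z : TPhase n | obstr k z i j = 0}} :=
    hS.preimage (measurable_update z)
  have hsec : {y : T3 × V3 | update z i y ∈ {z : TPhase n | obstr k z i j = 0}} =
      {y : T3 × V3 | ‖y.2 - (z j).2‖ ^ 2 • (Torus.reprSym (y.1 - (z j).1) - latticeVec k) -
        ⟪Torus.reprSym (y.1 - (z j).1) - latticeVec k, y.2 - (z j).2⟫_ℝ • (y.2 - (z j).2) = 0} := by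
    ext y
    simp only [mem_setOf_eq, obstr, relPos, relVel, update_self, update_of_ne hij.symm]
  rw [hsec] at hmeas ⊢
  rw [Measure.volume_eq_prod, Measure.measure_prod_null hmeas]
  have hae : ∀ᵐ x ∂(volume : Measure T3), x ≠ (z j).1 := by
    rw [ae_iff]
    simp only [ne_eq, not_not, setOf_eq_eq_singleton, measure_singleton]
  filter_upwards [hae] with x hx
  set a : V3 := Torus.reprSym (x - (z j).1) - latticeVec k with ha_def
  have ha : a ≠ 0 := by
    intro h0
    have h1 : proj (Torus.reprSym (x - (z j).1)) = proj (latticeVec k) := by rw [sub_eq_zero.1 h0]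
    rw [Torus.proj_reprSym, proj_latticeVec, sub_eq_zero] at h1
    exact hx h1
  have hsub : Prod.mk x ⁻¹' {y : T3 × V3 | ‖y.2 - (z j).2‖ ^ 2 • (Torus.reprSym (y.1 - (z j).1) - latticeVec k) -
        ⟪Torus.reprSym (y.1 - (z j).1) - latticeVec k, y.2 - (z j).2⟫_ℝ • (y.2 - (z j).2) = 0} ⊆
      (fun v => v + (-(z j).2)) ⁻¹' ((ℝ ∙ a : Submodule ℝ V3) : Set V3) := by
    intro v hv
    simp only [mem_preimage, mem_setOf_eq] at hv
    rw [← ha_def] at hv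
    show v + -(z j).2 ∈ ((ℝ ∙ a : Submodule ℝ V3) : Set V3)
    rw [← sub_eq_add_neg, SetLike.mem_coe]
    set w : V3 := v - (z j).2 with hw_def
    by_cases hw : w = 0
    · rw [hw]; exact zero_mem _
    · have hvs : ‖w‖ ^ 2 • a = ⟪a, w⟫_ℝ • w := sub_eq_zero.1 hv
      have hne : ⟪a, w⟫_ℝ ≠ 0 := by
        intro h0
        rw [h0, zero_smul, smul_eq_zero] at hvs
        rcases hvs with h | h
        · exact hw (by simpa using h)
        · exact ha h
      refine Submodule.mem_span_singleton.2 ⟨‖w‖ ^ 2 / ⟪a, w⟫_ℝ, ?_⟩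
      rw [div_eq_inv_mul, mul_smul, hvs, smul_smul, inv_mul_cancel₀ hne, one_smul]
  refine measure_mono_null hsub ?_
  rw [measure_preimage_add_right]
  exact Measure.addHaar_submodule volume _ (span_singleton_ne_top a ha)

/-- **Alexander's null set at diameter `0`**: Liouville-almost every datum is good. [folklore] -/
theorem volume_compl_good : volume (good n)ᶜ = 0 := by
  have : (good n)ᶜ = ⋃ i : Fin n, ⋃ j : Fin n, ⋃ (_ : i ≠ j), ⋃ k : Fin 3 → ℤ, {z | obstr k z i j = 0} := by
    ext z
    simp only [good, mem_compl_iff, mem_setOf_eq, mem_iUnion, not_forall, not_not, exists_prop, ne_eq]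
  rw [this]
  exact measure_iUnion_null fun i => measure_iUnion_null fun j => measure_iUnion_null fun hij =>
    measure_iUnion_null fun k => volume_setOf_obstr_eq_zero hij k

/-! ### The flow structure -/

/-- **The free gas as a hard-sphere flow of diameter `0` on `𝕋³`.** [folklore] -/
def freeFlow (n : ℕ) (ε : ℝ) (hε : ε = 0) : HardSphereFlow G3 ε n where
  flow t z := freeFlight G3 t z
  good := good n
  measurableSet_good := measurableSet_good
  good_subset := by subst hε; rw [hardSphereDomain_zero]; exact subset_univ _
  measure_compl_good := by
    subst hε
    rw [liouville_eq, hardSphereDomain_zero, Measure.restrict_univ]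
    exact volume_compl_good
  mapsTo_good t := fun _ hz => freeFlight_mem_good hz t
  flow_zero z _ := freeFlight_zero G3 z
  flow_add s t z _ := freeFlight_add G3 s t z
  measurable_flow t := measurable_freeFlight_torus t
  isTrajectory z hz := by subst hε; exact isHardSphereTrajectory_freeFlight hz
  measurePreserving t := by
    subst hε
    rw [liouville_eq, hardSphereDomain_zero, Measure.restrict_univ]
    exact Literature.Barriers.AtomisticToContinuum.measurePreserving_freeFlight_torus_holds t

/-- The flow map of `freeFlow` IS free flight (definitionally). [folklore] -/
@[simp] theorem freeFlow_flow (n : ℕ) {ε : ℝ} (hε : ε = 0) (t : ℝ) (z : TPhase n) :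
    (freeFlow n ε hε).flow t z = freeFlight G3 t z := rfl

/-- Reduced diameter `σ = 0` means diameter `0`. [folklore] -/
theorem hsDiameter_zero (N : ℕ) : hsDiameter 0 N = 0 := by simp [hsDiameter]

/-- The crux's flow type at reduced diameter `σ = 0` is inhabited by the free gas, for every `N`. [folklore] -/
def freeFlow₀ (N : ℕ) : HardSphereFlow G3 (hsDiameter 0 N) (N + 1) := freeFlow (N + 1) _ (hsDiameter_zero N)

end Summit.AtomisticToContinuum.HydrodynamicLimit.Theorems.CorrectorPressureDecayNegative.FreeFlow

end
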